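import Summits.QuantumAdvantage.QuantumAdvantage.Theorems.MobiusLadderLiouvilleOrthogonalTC0TransferCell
import Summits.QuantumAdvantage.QuantumAdvantage.Theorems.MobiusLadderLiouvilleOrthogonalTC0StubThin
import HarnessLib

/-!
# Crux `MobiusLadder.LiouvilleOrthogonalTC0` (stmt-QuantumAdvantage-1393), line `Sketch`: the transfer,
part 2 — the fixed-`n` estimate

For one `n`, with levels `z`, nontriviality thresholds `Vᵢ ≥ 2Yᵢ`, prime windows
`Iᵢ ⊆ (zᵢ, zᵢ₊₁] ∩ (Vᵢ, ∞)`, a test `g` whose dilates stay in a class `(d', s')` and hard-core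
measures on every qualifying piece, the correlation of `λ` with `sgn ∘ g ∘ bits` on `[0, 2ⁿ)` is at
most `(kθ2ⁿ + 1) + (kγ + (1-δ)^k₁)2ⁿ + #Bad + Σᵢ #Thinᵢ` (`transfer_fixed`, registered sub-goal):
sum over cells (keys = smooth part and boxes of the pieces); non-full cells are straddling
(`Transfer.card_straddle_le`, Bernoulli), full cells with `≥ k₁` qualifying coordinates fall under
`cell_full_bound` (part 1), and the remaining `N` are coprime to the primes of `≥ k₁` windows (`Bad`,
bounded in part 3 by the landed `stub_pieces`) or have a nontrivial thin piece (`Thinᵢ`, bounded by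
the landed `stub_thin`).
-/

set_option linter.dupNamespace false -- D-0017: single-problem summit ⇒ `QuantumAdvantage.QuantumAdvantage` by design

noncomputable section

namespace Summit.QuantumAdvantage.QuantumAdvantage.Theorems.LiouvilleOrthogonalTC0

open Filter Finset
open Literature.Computability.Complexity
open Literature.Probability.RandomGraphs.LowDegree (sgn)
open Summit.QuantumAdvantage.QuantumAdvantage.Theorems.MobiusLadder (abs_cast_liouville_le_one)

namespace Transfer

/-- Straddling numbers are few: `#{N < 2ⁿ : N > 2ⁿ/(1+θ)^k} ≤ kθ·2ⁿ + 1` (Bernoulli). -/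
theorem card_straddle_le (n k : ℕ) {θ : ℝ} (hθ : 0 < θ) (hθ1 : θ ≤ 1) :
    (#((range (2 ^ n)).filter fun N : ℕ => (2 : ℝ) ^ n / (1 + θ) ^ k < N) : ℝ) ≤
      k * θ * 2 ^ n + 1 := by
  -- the set lies in `Ioo L (2^n)` with `L = ⌊2ⁿ/(1+θ)^k⌋₊`, of size `≤ 2ⁿ - L ≤ 2ⁿ(1 - (1+θ)^{-k}) + 1`
  set x : ℝ := (2 : ℝ) ^ n / (1 + θ) ^ k with hx
  have hx0 : 0 ≤ x := by positivity
  have hsub : ((range (2 ^ n)).filter fun N : ℕ => x < N) ⊆ Finset.Ioo ⌊x⌋₊ (2 ^ n) := by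
    intro N hN
    rw [Finset.mem_filter, Finset.mem_range] at hN
    rw [Finset.mem_Ioo]
    exact ⟨(Nat.floor_lt hx0).mpr hN.2, hN.1⟩
  have hcard : (#((range (2 ^ n)).filter fun N : ℕ => x < N) : ℝ) ≤ (2 ^ n : ℝ) - ⌊x⌋₊ - 1 + 1 := by
    have h1 := Finset.card_le_card hsub
    rw [Nat.card_Ioo] at h1
    rcases le_or_gt (2 ^ n) ⌊x⌋₊ with h2 | h2
    · have : #((range (2 ^ n)).filter fun N : ℕ => x < N) = 0 := by omega
      rw [this]
      have hfl : (⌊x⌋₊ : ℝ) ≤ x := Nat.floor_le hx0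
      have hxle : x ≤ (2 : ℝ) ^ n := by
        rw [hx]; exact div_le_self (by positivity) (one_le_pow₀ (by linarith))
      push_cast; linarith
    · have h3 : (#((range (2 ^ n)).filter fun N : ℕ => x < N) : ℝ) ≤ ((2 ^ n - ⌊x⌋₊ - 1 : ℕ) : ℝ) := by
        exact_mod_cast h1
      rw [Nat.cast_sub (by omega), Nat.cast_sub h2.le] at h3
      push_cast at h3
      linarith
  -- Bernoulli: `x ≥ 2ⁿ(1 - kθ)`
  have hbern : (2 : ℝ) ^ n * (1 - k * θ) ≤ x := by
    rw [hx, le_div_iff₀ (by positivity)]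
    have h1 : (1 - θ) * (1 + θ) ≤ 1 := by nlinarith
    have h2 : 1 - (k : ℝ) * θ ≤ (1 - θ) ^ k := by
      have := one_add_mul_le_pow (show (-2 : ℝ) ≤ -θ by linarith) k
      rw [show (1 : ℝ) + -θ = 1 - θ by ring] at this
      linarith [this]
    have h3 : (1 - θ) ^ k * (1 + θ) ^ k ≤ 1 := by
      rw [← mul_pow]; exact pow_le_one₀ (by nlinarith) h1
    calc (2 : ℝ) ^ n * (1 - k * θ) * (1 + θ) ^ k ≤ (2 : ℝ) ^ n * ((1 - θ) ^ k * (1 + θ) ^ k) := by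
          rcases le_or_gt 0 (1 - (k : ℝ) * θ) with h4 | h4
          · rw [mul_assoc]; exact mul_le_mul_of_nonneg_left
              (mul_le_mul_of_nonneg_right h2 (by positivity)) (by positivity)
          · have : (2 : ℝ) ^ n * (1 - k * θ) * (1 + θ) ^ k ≤ 0 :=
              mul_nonpos_of_nonpos_of_nonneg (mul_nonpos_of_nonneg_of_nonpos (by positivity) h4.le)
                (by positivity)
            linarith [this, show (0 : ℝ) ≤ (2 : ℝ) ^ n * ((1 - θ) ^ k * (1 + θ) ^ k) by positivity]
      _ ≤ (2 : ℝ) ^ n * 1 := mul_le_mul_of_nonneg_left h3 (by positivity)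
      _ = (2 : ℝ) ^ n := mul_one _
  have hfl : x < ⌊x⌋₊ + 1 := Nat.lt_floor_add_one x
  linarith


/-- A prime of the window `(y, w]` dividing `N ≠ 0` divides the local part `locPart y w N`. -/
theorem prime_dvd_locPart {p y w N : ℕ} (hp : p.Prime) (hpN : p ∣ N) (hN : N ≠ 0) (h1 : y < p)
    (h2 : p ≤ w) : p ∣ locPart y w N := by
  have hmem : p ∈ N.primeFactors.filter (fun p => y < p ∧ p ≤ w) :=
    Finset.mem_filter.mpr ⟨Nat.mem_primeFactors.mpr ⟨hp, hpN, hN⟩, h1, h2⟩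
  have hdvd : p ^ N.factorization p ∣ locPart y w N := by
    unfold locPart
    exact Finset.dvd_prod_of_mem (fun q => q ^ N.factorization q) hmem
  refine dvd_trans ?_ hdvd
  exact dvd_pow_self p (Nat.Prime.factorization_pos_of_dvd hp hN hpN).ne'

end Transfer

open Transfer in
/-- **The fixed-`n` estimate.** With levels `z`, nontriviality thresholds `Vᵢ ≥ max(1, 2Yᵢ)`, prime
windows `Iᵢ ⊆ (zᵢ, zᵢ₊₁] ∩ (Vᵢ, ∞)`, a test `g` with dilates in a class `(d', s')`, and hard-core
measures available on every qualifying piece (hypothesis `hmeas`), the correlation of `λ` with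
`sgn ∘ g ∘ bits` on `[0, 2ⁿ)` is at most
`(kθ2ⁿ + 1) + (kγ + (1-δ)^k₁)2ⁿ + #Bad + Σᵢ #Thinᵢ`, where `Bad` are the `N` coprime to the primes of
at least `k₁ = k/2` windows (bounded by `stub_pieces`) and `Thinᵢ` the `N` whose `i`-th part is
nontrivial but thin (bounded by `stub_thin`). -/
theorem transfer_fixed (n k k₁ d' s' : ℕ) (hk : k = 2 * k₁) (hk₁ : 1 ≤ k₁) (θ γ δ T : ℝ)
    (hθ : 0 < θ) (hθ1 : θ ≤ 1) (hγ : 0 ≤ γ) (hδ : 0 < δ) (hδ1 : δ ≤ 1)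
    (z : Fin (k + 1) → ℕ) (hz : Monotone z) (htop : 2 ^ n ≤ z (Fin.last k))
    (Y V : Fin k → ℝ) (hVY : ∀ i, 2 * Y i ≤ V i)
    (I : Fin k → Finset ℕ)
    (hI : ∀ i, ∀ p ∈ I i, p.Prime ∧ z i.castSucc < p ∧ p ≤ z i.succ ∧ V i < p)
    (g : (Fin n → Bool) → Bool)
    (hdil : ∀ R : ℕ, ACRealOver tcBasis
      (fun x : Fin n → Bool =>
        g (fun i : Fin n => Nat.testBit ((∑ j : Fin n, (x j).toNat * 2 ^ (j : ℕ)) * R) i)) d' s')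
    (hmeas : ∀ (i : Fin k) (β : ℕ),
      (pieceSet n (z i.castSucc) (z i.succ) ((1 + θ) ^ β) θ).Nonempty →
      T ≤ #(pieceSet n (z i.castSucc) (z i.succ) ((1 + θ) ^ β) θ) →
      Y i ≤ (1 + θ) ^ β → (1 + θ) ^ (β + 1) ≤ (2 : ℝ) ^ n →
      ∃ M : ℕ → ℝ, (∀ u, 0 ≤ M u ∧ M u ≤ 1) ∧
        δ * #(pieceSet n (z i.castSucc) (z i.succ) ((1 + θ) ^ β) θ) ≤
          ∑ u ∈ pieceSet n (z i.castSucc) (z i.succ) ((1 + θ) ^ β) θ, M u ∧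
        ∀ g' : (Fin n → Bool) → Bool, ACRealOver tcBasis g' d' s' →
          |∑ u ∈ pieceSet n (z i.castSucc) (z i.succ) ((1 + θ) ^ β) θ,
              M u * (if g' (bits n u) = lamBit u then (1 : ℝ) else -1)| ≤
            γ * ∑ u ∈ pieceSet n (z i.castSucc) (z i.succ) ((1 + θ) ^ β) θ, M u) :
    |∑ N ∈ range (2 ^ n), ((ArithmeticFunction.liouville N : ℤ) : ℝ) * sgn (g (bits n N))| ≤
      (k * θ * 2 ^ n + 1) + (k * γ + (1 - δ) ^ k₁) * 2 ^ n +
      #((range (2 ^ n)).filter fun N =>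
          k ≤ 2 * #(univ.filter fun i : Fin k => ∀ p ∈ I i, ¬ p ∣ N)) +
      ∑ i : Fin k, (#((range (2 ^ n)).filter fun N => N ≠ 0 ∧
          V i < (locPart (z i.castSucc) (z i.succ) N : ℝ) ∧
          (#(pieceSet n (z i.castSucc) (z i.succ)
              ((1 + θ) ^ ⌊Real.log (locPart (z i.castSucc) (z i.succ) N) / Real.log (1 + θ)⌋₊) θ)
            : ℝ) < T) : ℝ) := by
  classical
  have hk0 : 1 ≤ k := by omega
  -- the summand
  set a : ℕ → ℝ := fun N => ((ArithmeticFunction.liouville N : ℤ) : ℝ) * sgn (g (bits n N)) with ha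
  have ha1 : ∀ N, |a N| ≤ 1 := fun N => by
    rw [ha, abs_mul]
    exact mul_le_one₀ (abs_cast_liouville_le_one N) (abs_nonneg _) (abs_sgn_le_one _)
  -- keys, cells
  set key : ℕ → ℕ × (Fin k → ℕ) := fun N =>
    (locPart 0 (z 0) N, fun i => ⌊Real.log (locPart (z i.castSucc) (z i.succ) N) / Real.log (1 + θ)⌋₊)
    with hkey
  set good : ℕ × (Fin k → ℕ) → Prop := fun c =>
    (c.1 : ℝ) * ∏ i, (1 + θ) ^ (c.2 i + 1) ≤ (2 : ℝ) ^ n ∧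
    k₁ ≤ #(univ.filter fun i : Fin k =>
      (pieceSet n (z i.castSucc) (z i.succ) ((1 + θ) ^ c.2 i) θ).Nonempty ∧
      T ≤ #(pieceSet n (z i.castSucc) (z i.succ) ((1 + θ) ^ c.2 i) θ) ∧ Y i ≤ (1 + θ) ^ c.2 i)
    with hgood
  set P := (range (2 ^ n)).filter (fun N => N ≠ 0) with hP
  -- the three exceptional sets
  set Straddle := (range (2 ^ n)).filter (fun N : ℕ => (2 : ℝ) ^ n / (1 + θ) ^ k < N) with hStr
  set Bad := (range (2 ^ n)).filter (fun N =>
    k ≤ 2 * #(univ.filter fun i : Fin k => ∀ p ∈ I i, ¬ p ∣ N)) with hBad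
  set Thin : Fin k → Finset ℕ := fun i => (range (2 ^ n)).filter (fun N => N ≠ 0 ∧
      V i < (locPart (z i.castSucc) (z i.succ) N : ℝ) ∧
      (#(pieceSet n (z i.castSucc) (z i.succ)
        ((1 + θ) ^ ⌊Real.log (locPart (z i.castSucc) (z i.succ) N) / Real.log (1 + θ)⌋₊) θ) : ℝ) < T)
    with hThin
  -- Step 0: drop `N = 0`
  have hS : ∑ N ∈ range (2 ^ n), a N = ∑ N ∈ P, a N := by
    rw [hP, Finset.sum_filter]
    refine Finset.sum_congr rfl fun N _ => ?_
    split_ifs with h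
    · rfl
    · simp only [ne_eq, Decidable.not_not] at h
      simp [ha, h]
  -- Step 1: classification of the non-good `N`
  have hclass : ∀ N ∈ P, ¬ good (key N) → N ∈ Straddle ∪ Bad ∪ univ.biUnion Thin := by
    intro N hNP hng
    rw [hP, Finset.mem_filter, Finset.mem_range] at hNP
    obtain ⟨hN2, hN0⟩ := hNP
    have hrecon := StubCells.recon hz htop hN0 hN2
    -- the parts and their boxes
    have hpc1 : ∀ i : Fin k, (1 : ℝ) ≤ locPart (z i.castSucc) (z i.succ) N := fun i => by
      exact_mod_cast Nat.one_le_iff_ne_zero.mpr (StubCells.isLocal_locPart _ _ N).1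
    have hbox : ∀ i : Fin k,
        (1 + θ) ^ ⌊Real.log (locPart (z i.castSucc) (z i.succ) N) / Real.log (1 + θ)⌋₊ ≤
          (locPart (z i.castSucc) (z i.succ) N : ℝ) ∧
        (locPart (z i.castSucc) (z i.succ) N : ℝ) <
          (1 + θ) ^ (⌊Real.log (locPart (z i.castSucc) (z i.succ) N) / Real.log (1 + θ)⌋₊ + 1) :=
      fun i => StubCells.box_mem hθ (hpc1 i)
    rw [Finset.mem_union, Finset.mem_union]
    by_cases hfull : ((key N).1 : ℝ) * ∏ i, (1 + θ) ^ ((key N).2 i + 1) ≤ (2 : ℝ) ^ n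
    · -- full but few qualifying coordinates: bad or thin
      have hfew : ¬ k₁ ≤ #(univ.filter fun i : Fin k =>
          (pieceSet n (z i.castSucc) (z i.succ) ((1 + θ) ^ (key N).2 i) θ).Nonempty ∧
          T ≤ #(pieceSet n (z i.castSucc) (z i.succ) ((1 + θ) ^ (key N).2 i) θ) ∧
          Y i ≤ (1 + θ) ^ (key N).2 i) := fun h => hng ⟨hfull, h⟩
      by_cases hthin : ∃ i, N ∈ Thin i
      · obtain ⟨i, hi⟩ := hthin
        exact Or.inr (Finset.mem_biUnion.mpr ⟨i, Finset.mem_univ i, hi⟩)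
      · left; right
        push Not at hthin
        -- every coordinate qualifies or is trivial
        have hqt : ∀ i : Fin k,
            ((pieceSet n (z i.castSucc) (z i.succ) ((1 + θ) ^ (key N).2 i) θ).Nonempty ∧
              T ≤ #(pieceSet n (z i.castSucc) (z i.succ) ((1 + θ) ^ (key N).2 i) θ) ∧
              Y i ≤ (1 + θ) ^ (key N).2 i) ∨ (∀ p ∈ I i, ¬ p ∣ N) := by
          intro i
          by_cases htriv : ∀ p ∈ I i, ¬ p ∣ N
          · exact Or.inr htriv
          · left
            push Not at htriv
            obtain ⟨p, hpI, hpN⟩ := htriv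
            obtain ⟨hp, hp1, hp2, hpV⟩ := hI i p hpI
            have hpdvd : p ∣ locPart (z i.castSucc) (z i.succ) N := prime_dvd_locPart hp hpN hN0 hp1 hp2
            have hpcV : V i < (locPart (z i.castSucc) (z i.succ) N : ℝ) := by
              have : (p : ℝ) ≤ locPart (z i.castSucc) (z i.succ) N := by
                exact_mod_cast Nat.le_of_dvd (Nat.pos_of_ne_zero (StubCells.isLocal_locPart _ _ N).1) hpdvd
              linarith
            have hmem := StubThin.locPart_mem_pieceSet n (z i.castSucc) (z i.succ) N hθ hN0 hN2
            have hne : (pieceSet n (z i.castSucc) (z i.succ) ((1 + θ) ^ (key N).2 i) θ).Nonempty :=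
              ⟨_, hmem⟩
            have hTle : T ≤ #(pieceSet n (z i.castSucc) (z i.succ) ((1 + θ) ^ (key N).2 i) θ) := by
              have hni := hthin i
              rw [hThin, Finset.mem_filter, Finset.mem_range] at hni
              by_contra hlt
              push Not at hlt
              exact hni ⟨hN2, hN0, hpcV, hlt⟩
            refine ⟨hne, hTle, ?_⟩
            -- the box is above `Y i`: `(1+θ)^β > u/(1+θ) ≥ u/2 > V/2 ≥ Y`
            have hb2 := (hbox i).2
            have hθ2 : (1 + θ) ≤ 2 := by linarith
            have hpow_pos : (0 : ℝ) < (1 + θ) ^ (key N).2 i := pow_pos (by linarith) _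
            rw [pow_succ] at hb2
            nlinarith [hVY i, hpow_pos]
        -- count: qualifying < k₁ and trivial < k₁ contradict `k = 2 k₁`
        have hcover : (Finset.univ : Finset (Fin k)) ⊆
            (univ.filter fun i : Fin k =>
              (pieceSet n (z i.castSucc) (z i.succ) ((1 + θ) ^ (key N).2 i) θ).Nonempty ∧
              T ≤ #(pieceSet n (z i.castSucc) (z i.succ) ((1 + θ) ^ (key N).2 i) θ) ∧
              Y i ≤ (1 + θ) ^ (key N).2 i) ∪
            (univ.filter fun i : Fin k => ∀ p ∈ I i, ¬ p ∣ N) := by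
          intro i _
          rw [Finset.mem_union, Finset.mem_filter, Finset.mem_filter]
          rcases hqt i with h | h
          · exact Or.inl ⟨Finset.mem_univ i, h⟩
          · exact Or.inr ⟨Finset.mem_univ i, h⟩
        have hcard := (Finset.card_le_card hcover).trans (Finset.card_union_le _ _)
        rw [Finset.card_univ, Fintype.card_fin] at hcard
        rw [hBad, Finset.mem_filter, Finset.mem_range]
        refine ⟨hN2, ?_⟩
        push Not at hfew
        omega
    · -- not full: straddling
      left; left
      rw [hStr, Finset.mem_filter, Finset.mem_range]
      refine ⟨hN2, ?_⟩
      push Not at hfull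
      have hθk : (0 : ℝ) < (1 + θ) ^ k := pow_pos (by linarith) _
      rw [div_lt_iff₀ hθk]
      -- `N = s ∏ uᵢ ≥ s ∏ (1+θ)^βᵢ` and `(1+θ)^k · that = s ∏ (1+θ)^(βᵢ+1) > 2ⁿ`
      have hN : (N : ℝ) =
          (locPart 0 (z 0) N : ℝ) * ∏ i : Fin k, (locPart (z i.castSucc) (z i.succ) N : ℝ) := by
        conv_lhs => rw [← hrecon]
        push_cast
        rfl
      have hge : ((key N).1 : ℝ) * ∏ i, (1 + θ) ^ ((key N).2 i) ≤ (N : ℝ) := by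
        rw [hN]
        apply mul_le_mul_of_nonneg_left _ (Nat.cast_nonneg _)
        exact Finset.prod_le_prod (fun i _ => by positivity) fun i _ => (hbox i).1
      have hsplit : ∏ i : Fin k, (1 + θ) ^ ((key N).2 i + 1) =
          (∏ i : Fin k, (1 + θ) ^ ((key N).2 i)) * (1 + θ) ^ k := by
        have : ∀ i : Fin k, (1 + θ) ^ ((key N).2 i + 1) = (1 + θ) ^ ((key N).2 i) * (1 + θ) :=
          fun i => pow_succ _ _
        rw [Finset.prod_congr rfl fun i _ => this i, Finset.prod_mul_distrib, Finset.prod_const,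
          Finset.card_univ, Fintype.card_fin]
      calc (2 : ℝ) ^ n < ((key N).1 : ℝ) * ∏ i, (1 + θ) ^ ((key N).2 i + 1) := hfull
        _ = (((key N).1 : ℝ) * ∏ i, (1 + θ) ^ ((key N).2 i)) * (1 + θ) ^ k := by
            rw [hsplit]; ring
        _ ≤ (N : ℝ) * (1 + θ) ^ k := mul_le_mul_of_nonneg_right hge hθk.le
  -- Step 2: good `N`, cell by cell
  set G := P.filter (fun N => good (key N)) with hGdef
  set B := P.filter (fun N => ¬ good (key N)) with hBdef
  have hsplit : ∑ N ∈ P, a N = ∑ N ∈ G, a N + ∑ N ∈ B, a N :=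
    (Finset.sum_filter_add_sum_filter_not P (fun N => good (key N)) a).symm
  have hfib : ∀ N₀ ∈ G, G.filter (fun N => key N = key N₀) =
      (range (2 ^ n)).filter (fun N => N ≠ 0 ∧ locPart 0 (z 0) N = (key N₀).1 ∧
        ∀ i : Fin k, ⌊Real.log (locPart (z i.castSucc) (z i.succ) N) / Real.log (1 + θ)⌋₊ =
          (key N₀).2 i) := by
    intro N₀ hN₀
    have hgood₀ : good (key N₀) := (Finset.mem_filter.mp hN₀).2
    ext N
    simp only [hGdef, hP, Finset.mem_filter, Finset.mem_range]
    constructor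
    · rintro ⟨⟨⟨hN2, hN0⟩, -⟩, hkN⟩
      refine ⟨hN2, hN0, ?_, fun i => ?_⟩
      · have := congrArg Prod.fst hkN; simpa [hkey] using this
      · have := congrArg (fun c => c.2 i) hkN; simpa [hkey] using this
    · rintro ⟨hN2, hN0, h1, h2⟩
      have hkN : key N = key N₀ := by
        simp only [hkey, Prod.mk.injEq]
        exact ⟨h1, funext h2⟩
      exact ⟨⟨⟨hN2, hN0⟩, hkN ▸ hgood₀⟩, hkN⟩
  have hmaps : ∀ N ∈ G, key N ∈ G.image key := fun N hN => Finset.mem_image_of_mem key hN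
  have hGsum : ∑ N ∈ G, a N = ∑ c ∈ G.image key, ∑ N ∈ G.filter (fun N => key N = c), a N :=
    (Finset.sum_fiberwise_of_maps_to hmaps a).symm
  have hGcard : (#G : ℝ) = ∑ c ∈ G.image key, (#(G.filter (fun N => key N = c)) : ℝ) := by
    exact_mod_cast Finset.card_eq_sum_card_fiberwise hmaps
  have hGbound : |∑ N ∈ G, a N| ≤ (k * γ + (1 - δ) ^ k₁) * #G := by
    rw [hGsum, hGcard, Finset.mul_sum]
    refine (Finset.abs_sum_le_sum_abs _ _).trans (Finset.sum_le_sum fun c hc => ?_)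
    obtain ⟨N₀, hN₀, rfl⟩ := Finset.mem_image.mp hc
    have hgood₀ : good (key N₀) := (Finset.mem_filter.mp hN₀).2
    rw [hfib N₀ hN₀]
    exact cell_full_bound n k k₁ d' s' hk0 θ γ δ T hθ hγ hδ hδ1 z hz htop Y g hdil hmeas
      (key N₀).1 (StubCells.isLocal_locPart 0 (z 0) N₀) (key N₀).2 hgood₀.1 hgood₀.2
  have hGle : (#G : ℝ) ≤ 2 ^ n := by
    have h1 : #G ≤ #(range (2 ^ n)) :=
      Finset.card_le_card ((Finset.filter_subset _ _).trans (Finset.filter_subset _ _))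
    rw [Finset.card_range] at h1
    exact_mod_cast h1
  -- Step 3: the non-good `N`
  have hBsub : B ⊆ Straddle ∪ Bad ∪ univ.biUnion Thin := fun N hN =>
    hclass N (Finset.mem_filter.mp hN).1 (Finset.mem_filter.mp hN).2
  have hBbound : |∑ N ∈ B, a N| ≤ #Straddle + #Bad + ∑ i, (#(Thin i) : ℝ) := by
    calc |∑ N ∈ B, a N| ≤ ∑ N ∈ B, |a N| := Finset.abs_sum_le_sum_abs _ _
      _ ≤ ∑ N ∈ B, (1 : ℝ) := Finset.sum_le_sum fun N _ => ha1 N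
      _ = #B := by simp
      _ ≤ #(Straddle ∪ Bad ∪ univ.biUnion Thin) := by exact_mod_cast Finset.card_le_card hBsub
      _ ≤ #Straddle + #Bad + ∑ i, (#(Thin i) : ℝ) := by
          have h1 := Finset.card_union_le (Straddle ∪ Bad) (univ.biUnion Thin)
          have h2 := Finset.card_union_le Straddle Bad
          have h3 : #(univ.biUnion Thin) ≤ ∑ i, #(Thin i) := Finset.card_biUnion_le
          calc (#(Straddle ∪ Bad ∪ univ.biUnion Thin) : ℝ) ≤ ((#Straddle + #Bad + ∑ i, #(Thin i) : ℕ) : ℝ) := by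
                exact_mod_cast h1.trans (by omega)
            _ = _ := by push_cast; ring
  have hStr_le : (#Straddle : ℝ) ≤ k * θ * 2 ^ n + 1 := card_straddle_le n k hθ hθ1
  -- combine
  rw [hS, hsplit]
  have hcoef : 0 ≤ (k * γ + (1 - δ) ^ k₁) := by positivity
  calc |∑ N ∈ G, a N + ∑ N ∈ B, a N| ≤ |∑ N ∈ G, a N| + |∑ N ∈ B, a N| := abs_add_le _ _
    _ ≤ (k * γ + (1 - δ) ^ k₁) * #G + (#Straddle + #Bad + ∑ i, (#(Thin i) : ℝ)) :=
        add_le_add hGbound hBbound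
    _ ≤ (k * γ + (1 - δ) ^ k₁) * 2 ^ n + ((k * θ * 2 ^ n + 1) + #Bad + ∑ i, (#(Thin i) : ℝ)) := by
        gcongr
    _ = _ := by ring

end Summit.QuantumAdvantage.QuantumAdvantage.Theorems.LiouvilleOrthogonalTC0
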